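import Literature.MathematicalPhysics.QuantumFieldTheory.Balaban1983to89.B8Thm2SetupTorusOfCubes
import Literature.MathematicalPhysics.QuantumFieldTheory.Balaban1983to89.B9GeoInputsMultiRateKLevelV1

/-!
# `Balaban1983to89.B8Thm2TorusKnitCubeGeometry` — M5.9 ASSEMBLY, FILE A10: the sixteen [Balaban1984PropagatorsII] §2 GEOMETRY fields of file A8's cube
# package `KnitCubeInputs` ((2.54), `d(y,y) = 0`, symmetry, `d ≥ 0`, Lemma 2.1 (2.61)∕(2.63) at the five rate pairs, the two p. 398 scale transfers of
# `(Lʲη)²` ∕ `(Lʲη)⁻⁴`, the final row sum) DISCHARGED FROM THE TREE above ONE member threshold `M_L ≤ M` (print: «for M sufficiently large»), and the G-B8-T2S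
# endpoint re-issued with ONLY the analytic cube data `KnitCubeAnalytic` (M5.5's Thm-3.7 data, M5.6's Thm-3.9 data), the (B)-lines and the catalogue displayed

statement-level skeleton of published theorems with citation tags; proofs where landed; nothing here is a claim about the
Yang–Mills mass gap

T. Bałaban, *Propagators and renormalization transformations for lattice gauge theories. II*, Commun. Math. Phys. **96** (1984) 223–250 [`Balaban1984PropagatorsII`,
"[4]"]: Lemma 2.1 (2.60)–(2.63) p. 234 (*«sup_{y∈𝔅} Σ_{y′∈𝔅} e^{−αδ₀d(y,y′)} ≦ c₁(α), (2.61)»*, *«for RM satisfying (2.59)»*), (2.59) p. 233, (2.54) p. 233.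
T. Bałaban, *Propagators for lattice gauge theories in a background field*, Commun. Math. Phys. **99** (1985) 389–434 [`Balaban1985BackgroundPropagators`, "[B9]"]:
p. 398 remark after (3.47) (*«Using Lemma 2.1 in [4] we may replace the factor (Lʲη)^α by (Lʲη)^β(L^{j′}η)^γ with β + γ = α»*), Thm 3.1 p. 397 (*«for M ≥ M₁»*),
Thm 3.7 p. 410, Thm 3.9 p. 413 (*«For M sufficiently large»*), Thm 3.2 (3.48) p. 398.  T. Bałaban, *Spaces of regular gauge field configurations on a lattice and
gauge fixing conditions*, Commun. Math. Phys. **99** (1985) 75–102 [`Balaban1985RegularSpaces`, "[B8]"]: Thm 2 p. 83, (1.33)–(1.39) pp. 82–83, p. 77.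
STATUS: published, refereed.

WHY THIS FILE ∕ THE ARGUMENT.  File A8's record `KnitCubeInputs i U b ιB Rr Hp p c s` mixes two kinds of fields: the ANALYTIC cube data of [B9] Thms 3.7 ∕ 3.9
(owners M5.1–M5.6 of sub-row G-B9-LETTERS) and the GEOMETRY of the member's block set — [4] (2.54), the metric axioms, Lemma 2.1 (2.61)∕(2.63) at the rate
pairs `(δG₀, αG₁)`, `((1−αG₁)δG₀, αG₂)`, `((1−α_G)δ_G, α₂)`, `(δ₀, b−ρ)`, `(ρδ₀, α′)`, `(ε₀, βₓ)`, the row sum at `ρ_f`, and the p. 398 scale transfers.  The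
geometry is KERNEL-CHECKED in the tree for every member of the k-level V1 family above an M-threshold: r06-lineage `B9GeoLemma21KLevelV1.rowSum261_geo9K` →
`B9RWSums347DefiniteFaces.ineq261_exp261_of_rowSum261` ((2.61) at the door exponent `exp261 geo9K δ α`, BY CHOICE), `B9Thm34Ext.h263_of_h261` (pv08's
«hence» (2.63)), `geo9K_dist_triangle∕_self∕_comm∕_nonneg'`, and p21's FILE 11 `B9GeoInputsMultiRateKLevelV1` (`ineq261_mono_exp`, `scaleTransfer_len_sq_geo9K`,
`scaleTransfer_len_inv4_geo9K` under the size conditions `2·log L ≦ αδ(2L²−1)M`, `4·log L ≦ αδ(2L²−1)M`).  This file takes the threshold as the `max` of the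
seven (2.61) thresholds and the two explicit size bounds, reads (2.61) at the record's exponents `p.d…` by monotonicity from the doors (`exp261 … ≤ p.d…`),
and splits A8's record accordingly.

CITATION HEADER (lean-in-tree rule).  Cell `lit-balaban`, seat `lit-balaban-t2s-1` (gen 5), MODULE M5.9, file A10; sub-row G-B8-T2S (R3 `stmt-QuantumFields-19200`,
helper).  REUSED BY NAME: the theorems just listed; file A8 `KnitCubeInputs`, `KnitCubeParams`; file A9 `thm2SetupSUAt_ofCubes_exists`.

WHAT THIS FILE DECLARES ∕ PROVES (sorry-free).
* §1 `KnitCubeGeoValid` — the positivity of the nine rate products, `δG₀, (1−αG₁)δG₀, ρδ₀ ≥ 0`, `αG₁, αG₂, α′ ≤ 1`, the record's exponents above the family's doors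
  (`exp261 geo9K δ α ≤ p.d…`, `p.d′` above both doors of its two pairs), the scale-transfer constants above `L²`, `L⁴`, and a row-sum exponent `dρ`;
  `KnitCubeGeometry i Rr Hp p c` — the sixteen geometry fields of `KnitCubeInputs`, verbatim; `scaleTransfer_mono_const`.
* §2 ★★★ **`exists_threshold_knitCubeGeometry`** — `KnitCubeGeoValid … p dρ` ⟹ `∃ M_L, ∀ i, M_L ≤ (geo9K i).M → KnitCubeGeometry i Rr Hp p (c₁(dρ, ρ_f, 1))`.
* §3 `KnitCubeAnalytic i U b ιB Rr Hp p s` — the analytic fields of `KnitCubeInputs` (M5.5's Thm-3.7 cube data at `parSymY`, M5.6's Thm-3.9 per-cube data at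
  `parKnitY`, the member's section `ιB`, units `c_f = Lᵏ`, `η_S⁴s = 1`); `KnitCubeInputs.ofGeometry` — geometry + analytic ⟹ A8's record.
* §4 ★★★★★★★ **`thm2SetupSUAt_ofCubeAnalytic_exists`** — for `1 ≤ N ≤ 25`, `d + 1 ≥ 2`: `∃ M_L B₁ B₂ c₁`, `0 < B₁ ∧ 0 < B₂ ∧ 0 < c₁`, such that for every
  `m K k η` (`1 ≤ k ≤ m + K`, `η > 0`): catalogue props (constant level, level slack, members ABOVE `M_L`) → analytic cube data at every member and every
  `SU(N)`-valued periodic background of the class → (B)-lines → `Thm2SetupSUAt (PV d ℓ m K hd hL) N k η 0 B₁ B₂ c₁ len (fun _ => True)`.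

HONEST SCOPE.  Plumbing: the geometry is discharged by name from landed theorems (their own located caveats apply: the (2.61) thresholds are EXISTENTIAL — the
door construction is by choice, no numerical `M` asserted; `c₁` enters as an `α`-dependent O(1), cell record GAPS G-A11-1∕G-A12-1); the analytic cube data
(Cor. 3.6 at the cube letters, (3.88)–(3.89), left entries, local inverse property, per-cube (3.48) blocks, the [2]-difference majorants `hD` = GAP G-B9-05,
cut-offs), the (B)-lines and the catalogue remain DISPLAYED, inhabited by nothing here; count-neutral; N05 ∕ `stub_PV3A` NOT discharged; nothing continuum ∕
ℝ⁴ ∕ OS ∕ mass-gap ∕ Clay — the Yang–Mills mass gap is NOT proved.  No `sorry`, no `axiom`, no `… : Prop` fact (records are hypothesis shapes with every field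
displayed), no `instance`, no `notation`.  NEW file; nothing landed is modified.  Seat `lit-balaban-t2s-1` gen 5, 2026-08-28.
-/

noncomputable section

open scoped BigOperators

namespace Literature.MathematicalPhysics.QuantumFieldTheory.Balaban1983to89.B8Thm2TorusKnitCubeGeometry

open Node00 B6KLevelCensusIndexV1 B6Geom246MultiLevelBox B9BackgroundsKLevelV1 B9Eq39Adjoint B9Thm311ReadingCoords B9Thm311DeltaPrimePos
open B7Prop1Explicit renaming Site → LSite
open B7Prop1Explicit (e)
open B6RandomWalk (HasMajorant Triangle254 Ineq261 Ineq263 c1_nonneg)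
open B9Thm34Ext (toB6 h263_of_h261)
open B9GeoNormsKLevelV1 (geo9K geo9K_len_kGeo)
open B9Eq352DivFormLetters (conj)
open B9Eq352GradLetters (diffLetter)
open B9Thm37CubeCoverCommutators (cutMulY)
open B9Ineq347 (ScaleTransfer)
open B9RWSums347DefiniteFaces (exp261 ineq261_exp261_of_rowSum261)
open B9GeoLemma21KLevelV1 (rowSum261_geo9K geo9K_dist_triangle geo9K_dist_self geo9K_dist_comm geo9K_dist_nonneg' geo9K_M_nonneg)
open B9GeoInputsMultiRateKLevelV1 (ineq261_mono_exp scaleTransfer_len_sq_geo9K scaleTransfer_len_inv4_geo9K)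
open B8Ineq132 (InAk)
open B6GlobalChartV1 (PV)
open B9B8AveragingJunction (parKnitY)
open B8Thm2TorusLettersPerOfKnit (bgY)
open B8Thm2TorusKnitEstimatesOfMajorants (B9P3PerAt)
open B8Thm2TorusKnitMajorantsOfCubes (KnitCubeParams KnitCubeInputs)
open B8Thm2SetupTorusOfCubes (thm2SetupSUAt_ofCubes_exists)
open B7Prop2SpecialUnitary (specialUnitaryUnits)
open B8Thm2SetupTorus (Thm2SetupSUAt)
open scoped Matrix Matrix.Norms.L2Operator

variable {d ℓ : ℕ} {hd : 1 ≤ d + 1} {hL : Odd (ℓ + 1) ∧ 1 < ℓ + 1} {b₀ b₁ : ℝ}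

/-! ## §1 The geometry fields of the cube package and the side conditions that let the tree discharge them -/

section Shapes

/-- **THE GEOMETRIC SIDE CONDITIONS ON THE SCALARS** (member-free): the nine rate products are positive (Lemma 2.1 needs `αδ₀ > 0`), `δG₀, (1−αG₁)δG₀, ρδ₀ ≥ 0` and `αG₁, αG₂, α′ ≤ 1`
((2.63)), the record's exponents lie above the family's (2.61) doors `exp261 geo9K δ α` (BY CHOICE; (2.61) is monotone in the exponent), `p.d′` above both doors
of its two pairs, the scale-transfer constants above `L²` ∕ `L⁴`, and a row-sum exponent `dρ` above the door of `(ρ_f, 1)`.  The `Fintype` structures on the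
members' block sets are a parameter (any choice; `Fintype` is a subsingleton).
[cite: Balaban1984PropagatorsII, Lemma 2.1 (2.61)–(2.63) p.234, (2.59) p.233; Balaban1985BackgroundPropagators, p.398 remark after (3.47)] -/
structure KnitCubeGeoValid (d ℓ : ℕ) (hd : 1 ≤ d + 1) (hL : Odd (ℓ + 1) ∧ 1 < ℓ + 1) (b₀ b₁ : ℝ)
    [∀ i : KIdx d ℓ hd hL b₀ b₁, Fintype (geo9K i).Site] (p : KnitCubeParams) (dρ : ℕ) : Prop where
  /-- `αG₁·δG₀ > 0`. -/
  hG₁ : 0 < p.αG₁ * p.δG₀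
  /-- `δG₀ ≥ 0`. -/
  hδG₀ : 0 ≤ p.δG₀
  /-- `αG₁ ≤ 1`. -/
  hαG₁ : p.αG₁ ≤ 1
  /-- `αG₂·(1−αG₁)δG₀ > 0`. -/
  hG₂ : 0 < p.αG₂ * ((1 - p.αG₁) * p.δG₀)
  /-- `(1−αG₁)δG₀ ≥ 0`. -/
  hαδ₁ : 0 ≤ (1 - p.αG₁) * p.δG₀
  /-- `αG₂ ≤ 1`. -/
  hαG₂ : p.αG₂ ≤ 1
  /-- `α₂·(1−α_G)δ_G > 0`. -/
  hGw : 0 < p.α₂ * ((1 - p.αG) * p.δG)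
  /-- `α_G·δ_G > 0` (scale transfer of `ℓ²`). -/
  hTG : 0 < p.αG * p.δG
  /-- `(b−ρ)·δ₀ > 0`. -/
  hb : 0 < (p.bb - p.ρ) * p.δ₀
  /-- `α′·ρδ₀ > 0`. -/
  hfin : 0 < p.α' * (p.ρ * p.δ₀)
  /-- `ρδ₀ ≥ 0`. -/
  hρδ₀ : 0 ≤ p.ρ * p.δ₀
  /-- `α′ ≤ 1`. -/
  hα' : p.α' ≤ 1
  /-- `α_st·δ₀ > 0` (scale transfer of `ℓ⁻⁴`). -/
  hT4 : 0 < p.αst * p.δ₀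
  /-- `βₓ·ε₀ > 0`. -/
  hf : 0 < p.βx * p.ε₀
  /-- `ρ_f > 0`. -/
  hρf : 0 < 1 * p.ρf
  /-- door of `(δG₀, αG₁)` below `dG₁`. -/
  hdG₁ : exp261 (geo9K (d := d) (ℓ := ℓ) (hd := hd) (hL := hL) (b₀ := b₀) (b₁ := b₁)) p.δG₀ p.αG₁ ≤ p.dG₁
  /-- door of `((1−αG₁)δG₀, αG₂)` below `dG₂`. -/
  hdG₂ : exp261 (geo9K (d := d) (ℓ := ℓ) (hd := hd) (hL := hL) (b₀ := b₀) (b₁ := b₁)) ((1 - p.αG₁) * p.δG₀) p.αG₂ ≤ p.dG₂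
  /-- door of `((1−α_G)δ_G, α₂)` below `d₂`. -/
  hd₂ : exp261 (geo9K (d := d) (ℓ := ℓ) (hd := hd) (hL := hL) (b₀ := b₀) (b₁ := b₁)) ((1 - p.αG) * p.δG) p.α₂ ≤ p.d₂
  /-- door of `(δ₀, b−ρ)` below `d′`. -/
  hd'b : exp261 (geo9K (d := d) (ℓ := ℓ) (hd := hd) (hL := hL) (b₀ := b₀) (b₁ := b₁)) p.δ₀ (p.bb - p.ρ) ≤ p.d'
  /-- door of `(ρδ₀, α′)` below `d′`. -/
  hd'f : exp261 (geo9K (d := d) (ℓ := ℓ) (hd := hd) (hL := hL) (b₀ := b₀) (b₁ := b₁)) (p.ρ * p.δ₀) p.α' ≤ p.d'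
  /-- door of `(ε₀, βₓ)` below `d₁`. -/
  hd₁ : exp261 (geo9K (d := d) (ℓ := ℓ) (hd := hd) (hL := hL) (b₀ := b₀) (b₁ := b₁)) p.ε₀ p.βx ≤ p.d₁
  /-- door of `(ρ_f, 1)` below `dρ`. -/
  hdρ : exp261 (geo9K (d := d) (ℓ := ℓ) (hd := hd) (hL := hL) (b₀ := b₀) (b₁ := b₁)) p.ρf 1 ≤ dρ
  /-- the scale-transfer constant of `ℓ²` is above `L²`. -/
  hCG : ((ℓ : ℝ) + 1) ^ 2 ≤ p.CG
  /-- the scale-transfer constant of `ℓ⁻⁴` is above `L⁴`. -/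
  hC : ((ℓ : ℝ) + 1) ^ 4 ≤ p.C

variable (i : KIdx d ℓ hd hL b₀ b₁) [Fintype (geo9K i).Site] (Rr : ℝ) (Hp : Prop) (p : KnitCubeParams) (c : ℝ)

/-- **THE SIXTEEN GEOMETRY FIELDS OF FILE A8's `KnitCubeInputs`, VERBATIM** (member-level; no background): (2.54), `d(y,y) = 0`, symmetry, `d ≥ 0`, the row sum at
`ρ_f` with constant `c`, (2.61) at `(ε₀, βₓ)`, (2.61)∕(2.63) at `(δG₀, αG₁)` and `((1−αG₁)δG₀, αG₂)`, the scale transfer of `ℓ²` at `(δ_G, α_G, C_G)`, (2.61) at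
`((1−α_G)δ_G, α₂)`, the scale transfer of `ℓ⁻⁴` at `(δ₀, α_st, C)`, (2.61) at `(δ₀, b−ρ)`, (2.61)∕(2.63) at `(ρδ₀, α′)`.
[cite: Balaban1984PropagatorsII, (2.54) p.233, Lemma 2.1 (2.61)–(2.63) p.234; Balaban1985BackgroundPropagators, p.398 remark after (3.47)] -/
structure KnitCubeGeometry : Prop where
  /-- [4] (2.54). -/
  htri : Triangle254 (toB6 (geo9K i) Rr Hp)
  /-- `d(y,y) = 0`. -/
  hrefl : ∀ y : (geo9K i).Site, (geo9K i).dist y y = 0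
  /-- symmetry of `d`. -/
  hsymm : ∀ a a' : (geo9K i).Site, (geo9K i).dist a a' = (geo9K i).dist a' a
  /-- `d ≥ 0`. -/
  hdnn : ∀ a a' : (geo9K i).Site, 0 ≤ (geo9K i).dist a a'
  /-- the row sum at the final rate `ρ_f`. -/
  hrow : ∀ a : (geo9K i).Site, ∑ a' : (geo9K i).Site, Real.exp (-(p.ρf * (geo9K i).dist a a')) ≤ c
  /-- (2.61) at `(ε₀, βₓ)`. -/
  h261f : Ineq261 p.d₁ (toB6 (geo9K i) Rr Hp) p.ε₀ p.βx
  /-- (2.61) at `(δG₀, αG₁)`. -/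
  h261G₁ : Ineq261 p.dG₁ (toB6 (geo9K i) Rr Hp) p.δG₀ p.αG₁
  /-- (2.63) at `(δG₀, αG₁)`. -/
  h263G₁ : Ineq263 p.dG₁ (toB6 (geo9K i) Rr Hp) p.δG₀ p.αG₁
  /-- (2.61) at `((1−αG₁)δG₀, αG₂)`. -/
  h261G₂ : Ineq261 p.dG₂ (toB6 (geo9K i) Rr Hp) ((1 - p.αG₁) * p.δG₀) p.αG₂
  /-- (2.63) at `((1−αG₁)δG₀, αG₂)`. -/
  h263G₂ : Ineq263 p.dG₂ (toB6 (geo9K i) Rr Hp) ((1 - p.αG₁) * p.δG₀) p.αG₂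
  /-- scale transfer of `ℓ²` at `α_G`. -/
  hSTG : ScaleTransfer (geo9K i) p.δG p.αG p.CG (fun a => (geo9K i).len a ^ 2)
  /-- (2.61) at `((1−α_G)δ_G, α₂)`. -/
  h261Gw : Ineq261 p.d₂ (toB6 (geo9K i) Rr Hp) ((1 - p.αG) * p.δG) p.α₂
  /-- scale transfer of `ℓ⁻⁴` at `α_st`. -/
  hST : ScaleTransfer (geo9K i) p.δ₀ p.αst p.C (fun a => ((geo9K i).len a ^ 4)⁻¹)
  /-- (2.61) at `(δ₀, b − ρ)`. -/
  h261b : Ineq261 p.d' (toB6 (geo9K i) Rr Hp) p.δ₀ (p.bb - p.ρ)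
  /-- (2.61) at `(ρδ₀, α′)`. -/
  h261 : Ineq261 p.d' (toB6 (geo9K i) Rr Hp) (p.ρ * p.δ₀) p.α'
  /-- (2.63) at `(ρδ₀, α′)`. -/
  h263 : Ineq263 p.d' (toB6 (geo9K i) Rr Hp) (p.ρ * p.δ₀) p.α'

variable {i Rr Hp p c}

omit [Fintype (geo9K i).Site] in
/-- a scale transfer holds with any larger constant (the weight is non-negative). [cite: Balaban1985BackgroundPropagators, p.398 remark after (3.47), bookkeeping] -/
theorem scaleTransfer_mono_const {δ α C C' : ℝ} {w : (geo9K i).Site → ℝ} (hw : ∀ a, 0 ≤ w a) (hC : C ≤ C')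
    (h : ScaleTransfer (geo9K i) δ α C w) : ScaleTransfer (geo9K i) δ α C' w :=
  fun y y' => (h y y').trans (mul_le_mul_of_nonneg_right hC (hw y))

end Shapes

/-! ## §2 ★★★ The geometry fields hold for every member above one threshold -/

section Threshold

variable [instF : ∀ i : KIdx d ℓ hd hL b₀ b₁, Fintype (geo9K i).Site]

/-- arithmetic: a size condition `a ≤ κ·q·M` holds once `a ∕ (κ·q) ≤ M` (`κ·q > 0`). [cite: Balaban1984PropagatorsII, (2.59) p.233, bookkeeping] -/
theorem size_of_threshold {a κ q M : ℝ} (hκq : 0 < κ * q) (hM : a / (κ * q) ≤ M) : a ≤ κ * q * M := by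
  rw [div_le_iff₀ hκq] at hM; linarith [mul_comm (κ * q) M]

/-- ★★★ **THE [4] §2 GEOMETRY OF THE CUBE PACKAGE, FOR EVERY MEMBER OF THE k-LEVEL V1 FAMILY ABOVE ONE THRESHOLD** (print: Thm 3.1 «for M ≥ M₁», Thm 3.9 «For M
sufficiently large»; [4] Lemma 2.1 «for RM satisfying (2.59)»): under `KnitCubeGeoValid … p dρ`, there is `M_L` such that every member `i` with `M_L ≤ (geo9K i).M` satisfies
`KnitCubeGeometry i Rr Hp p (c₁(dρ, ρ_f, 1))`, for ANY transport letters `Rr`, `Hp`.  Proof: seven instances of `ineq261_exp261_of_rowSum261` on `rowSum261_geo9K`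
read at the record's exponents by `ineq261_mono_exp`, (2.63) by `h263_of_h261`, the metric axioms by `geo9K_dist_*`, the two scale transfers by p21's FILE 11 under
the size conditions folded into the threshold (`2·log L∕(α_Gδ_G(2L²−1))`, `4·log L∕(α_stδ₀(2L²−1)) ≤ M`).
[cite: Balaban1984PropagatorsII, Lemma 2.1 (2.60)–(2.63) p.234, (2.59) p.233, (2.54) p.233; Balaban1985BackgroundPropagators, p.398 remark after (3.47), Thm 3.1 p.397, Thm 3.9 p.413] -/
theorem exists_threshold_knitCubeGeometry (Rr : ℝ) (Hp : Prop) {p : KnitCubeParams} {dρ : ℕ} (hg : KnitCubeGeoValid d ℓ hd hL b₀ b₁ p dρ) :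
    ∃ ML : ℝ, ∀ i : KIdx d ℓ hd hL b₀ b₁, ML ≤ (geo9K i).M → KnitCubeGeometry i Rr Hp p (B6.c1 dρ p.ρf 1) := by
  have hrow := rowSum261_geo9K (d := d) (ℓ := ℓ) (hd := hd) (hL := hL) (b₀ := b₀) (b₁ := b₁)
  -- the seven (2.61) thresholds
  obtain ⟨M₁, h₁⟩ := ineq261_exp261_of_rowSum261 (geo := geo9K (d := d) (ℓ := ℓ) (hd := hd) (hL := hL) (b₀ := b₀) (b₁ := b₁))
    (fun _ => Rr) (fun _ => Hp) hg.hG₁ hrow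
  obtain ⟨M₂, h₂⟩ := ineq261_exp261_of_rowSum261 (geo := geo9K (d := d) (ℓ := ℓ) (hd := hd) (hL := hL) (b₀ := b₀) (b₁ := b₁))
    (fun _ => Rr) (fun _ => Hp) hg.hG₂ hrow
  obtain ⟨M₃, h₃⟩ := ineq261_exp261_of_rowSum261 (geo := geo9K (d := d) (ℓ := ℓ) (hd := hd) (hL := hL) (b₀ := b₀) (b₁ := b₁))
    (fun _ => Rr) (fun _ => Hp) hg.hGw hrow
  obtain ⟨M₄, h₄⟩ := ineq261_exp261_of_rowSum261 (geo := geo9K (d := d) (ℓ := ℓ) (hd := hd) (hL := hL) (b₀ := b₀) (b₁ := b₁))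
    (fun _ => Rr) (fun _ => Hp) hg.hb hrow
  obtain ⟨M₅, h₅⟩ := ineq261_exp261_of_rowSum261 (geo := geo9K (d := d) (ℓ := ℓ) (hd := hd) (hL := hL) (b₀ := b₀) (b₁ := b₁))
    (fun _ => Rr) (fun _ => Hp) hg.hfin hrow
  obtain ⟨M₆, h₆⟩ := ineq261_exp261_of_rowSum261 (geo := geo9K (d := d) (ℓ := ℓ) (hd := hd) (hL := hL) (b₀ := b₀) (b₁ := b₁))
    (fun _ => Rr) (fun _ => Hp) hg.hf hrow
  obtain ⟨M₇, h₇⟩ := ineq261_exp261_of_rowSum261 (geo := geo9K (d := d) (ℓ := ℓ) (hd := hd) (hL := hL) (b₀ := b₀) (b₁ := b₁))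
    (fun _ => Rr) (fun _ => Hp) hg.hρf hrow
  -- the two scale-transfer size conditions as thresholds
  set Lr : ℝ := (ℓ : ℝ) + 1 with hLr
  set T₁ : ℝ := 2 * Real.log Lr / (p.αG * p.δG * (2 * Lr ^ 2 - 1)) with hT₁
  set T₂ : ℝ := 4 * Real.log Lr / (p.αst * p.δ₀ * (2 * Lr ^ 2 - 1)) with hT₂
  have hq : 0 < 2 * Lr ^ 2 - 1 := by
    have : (1 : ℝ) ≤ Lr := by rw [hLr]; linarith [Nat.cast_nonneg (α := ℝ) ℓ]
    nlinarith
  refine ⟨max (max (max M₁ M₂) (max M₃ M₄)) (max (max M₅ M₆) (max M₇ (max T₁ T₂))), fun i hM => ?_⟩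
  -- unpack the threshold
  have hM₁ : M₁ ≤ (geo9K i).M := le_trans (by simp) hM
  have hM₂ : M₂ ≤ (geo9K i).M := le_trans (by simp) hM
  have hM₃ : M₃ ≤ (geo9K i).M := le_trans (by simp) hM
  have hM₄ : M₄ ≤ (geo9K i).M := le_trans (by simp) hM
  have hM₅ : M₅ ≤ (geo9K i).M := le_trans (by simp) hM
  have hM₆ : M₆ ≤ (geo9K i).M := le_trans (by simp) hM
  have hM₇ : M₇ ≤ (geo9K i).M := le_trans (by simp) hM
  have hMT₁ : T₁ ≤ (geo9K i).M := le_trans (by simp) hM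
  have hMT₂ : T₂ ≤ (geo9K i).M := le_trans (by simp) hM
  have htri : Triangle254 (toB6 (geo9K i) Rr Hp) := (B9Thm34Ext.triangle254_toB6_iff (geo9K i) Rr Hp).2 (geo9K_dist_triangle i)
  have hlen0 : ∀ a : (geo9K i).Site, 0 ≤ (geo9K i).len a := fun a => by rw [geo9K_len_kGeo]; exact (len_pos i a).le
  -- (2.61) at the record's exponents
  have e₁ : Ineq261 p.dG₁ (toB6 (geo9K i) Rr Hp) p.δG₀ p.αG₁ := ineq261_mono_exp hg.hG₁ hg.hdG₁ (h₁ i hM₁)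
  have e₂ : Ineq261 p.dG₂ (toB6 (geo9K i) Rr Hp) ((1 - p.αG₁) * p.δG₀) p.αG₂ := ineq261_mono_exp hg.hG₂ hg.hdG₂ (h₂ i hM₂)
  have e₅ : Ineq261 p.d' (toB6 (geo9K i) Rr Hp) (p.ρ * p.δ₀) p.α' := ineq261_mono_exp hg.hfin hg.hd'f (h₅ i hM₅)
  have e₇ : Ineq261 dρ (toB6 (geo9K i) Rr Hp) p.ρf 1 := ineq261_mono_exp hg.hρf hg.hdρ (h₇ i hM₇)
  exact
  { htri := htri
    hrefl := geo9K_dist_self i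
    hsymm := geo9K_dist_comm i
    hdnn := geo9K_dist_nonneg' i
    hrow := fun a =>
      calc ∑ a' : (geo9K i).Site, Real.exp (-(p.ρf * (geo9K i).dist a a'))
          = ∑ a' : (geo9K i).Site, Real.exp (-(1 * p.ρf * (toB6 (geo9K i) Rr Hp).dist a a')) :=
            Finset.sum_congr rfl fun a' _ => by rw [one_mul]; rfl
        _ ≤ B6.c1 dρ p.ρf 1 := e₇ a
    h261f := ineq261_mono_exp hg.hf hg.hd₁ (h₆ i hM₆)
    h261G₁ := e₁
    h263G₁ := h263_of_h261 (geo9K i) Rr Hp _ _ _ htri hg.hδG₀ hg.hαG₁ e₁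
    h261G₂ := e₂
    h263G₂ := h263_of_h261 (geo9K i) Rr Hp _ _ _ htri hg.hαδ₁ hg.hαG₂ e₂
    hSTG := scaleTransfer_mono_const (fun a => sq_nonneg _) hg.hCG
      (scaleTransfer_len_sq_geo9K i hg.hTG (size_of_threshold (mul_pos hg.hTG hq) hMT₁))
    h261Gw := ineq261_mono_exp hg.hGw hg.hd₂ (h₃ i hM₃)
    hST := scaleTransfer_mono_const (fun a => inv_nonneg.2 (pow_nonneg (hlen0 a) 4)) hg.hC
      (scaleTransfer_len_inv4_geo9K i hg.hT4 (size_of_threshold (mul_pos hg.hT4 hq) hMT₂))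
    h261b := ineq261_mono_exp hg.hb hg.hd'b (h₄ i hM₄)
    h261 := e₅
    h263 := h263_of_h261 (geo9K i) Rr Hp _ _ _ htri hg.hρδ₀ hg.hα' e₅ }

end Threshold

/-! ## §3 The analytic cube data and the split of file A8's record -/

section Analytic

variable {N : ℕ} (i : KIdx d ℓ hd hL b₀ b₁) (U : CfgY (Matrix (Fin N) (Fin N) ℂ) i)
variable {ι : Type} [Fintype ι] (b : Module.Basis ι ℝ (Matrix (Fin N) (Fin N) ℂ))
variable [Fintype (geo9K i).Site] [DecidableEq (geo9K i).Site] (ιB : BlkY i → IBondY i) (Rr : ℝ) (Hp : Prop) (p : KnitCubeParams) (s : ℝ)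

/-- **THE ANALYTIC CUBE DATA AT ONE MEMBER AND ONE BACKGROUND** — file A8's `KnitCubeInputs` minus its sixteen geometry fields: the member's section `ιB`, units
`c_f = Lᵏ`, `η_S⁴s = 1`; M5.5's [B9] Thm-3.7 cube data at def-Y's letter of record `parSymY` (cubes `κ`, supports, cube terms `T_□`, remainders `R_□`, left entries
`K_{E,□}^μ`, Cor.-3.6 block majorants `hT`, (3.89) `h389`, (3.88) `h388`, `hTE`, `hKE`, overlap counts); M5.6's [B9] Thm-3.9 per-cube data at print's transporters
`parKnitY` (cube letters `Oc`, cut-offs `h_□`, `χ_□`, supports, local inverses `Cl` with the local inverse property `hloc`, per-cube (3.48) blocks `hC`, [2]-difference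
majorants `hD`, site majorants `hGc` of the cube letters, separation, slow variation).  A hypothesis SHAPE (owners: M5.1b∕c, M5.2, M5.4, M5.5, M5.6).
[cite: Balaban1985BackgroundPropagators, Thm 3.7 (3.87)–(3.90) pp.409–410, Cor 3.6 p.408, Thm 3.9 p.413, (3.95)–(3.96) p.411, Thm 3.1 (3.42) p.397, Thm 3.2 (3.48) p.398, (3.19) p.393, (3.24)–(3.25) p.394; Balaban1984PropagatorsII, (2.52) p.232, (2.83)–(2.85) p.237] -/
structure KnitCubeAnalytic : Type 1 where
  /-- the section `ιB` of the carrier-block map `β`. -/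
  hι : ∀ t, B6Ineq2142KLevelV1.β i.hN i.D i.hk (ιB t) = t
  /-- print's units `c_f = Lᵏ`. -/
  hcf : i.cf = (((ℓ + 1 : ℕ) : ℝ)) ^ i.k
  /-- the unit of `C`: `η_S⁴·s = 1`. -/
  hs : (etaS i ^ 2 * etaS i ^ 2) * s = 1
  /-- the index type of M5.5's cubes. -/
  κ : Type
  /-- it is finite. -/
  [instκ : Fintype κ]
  /-- supports of the cube terms. -/
  SG : κ → Finset (geo9K i).Site
  /-- supports of the remainders. -/
  SG' : κ → Finset (geo9K i).Site
  /-- the cube terms `T_□`. -/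
  T : κ → Module.End ℝ (SiteY i → Matrix (Fin N) (Fin N) ℂ)
  /-- the remainders `R_□`. -/
  R : κ → Module.End ℝ (SiteY i → Matrix (Fin N) (Fin N) ℂ)
  /-- the left-entry block majorants `K_{E,□}^μ`. -/
  KE : Fin (d + 1) → κ → (geo9K i).Site → (geo9K i).Site → ℝ
  /-- Cor. 3.6 block majorants of the cube terms. -/
  hT : ∀ k, HasMajorant (g := toB6 (geo9K i) Rr Hp) (fun q : SiteY i × ι => ιB (blkOf i.D.toDomains q.1)) (conj b ((etaS i ^ 2) • T k))
    (fun a a' => if a ∈ SG k then p.BG₀ * (geo9K i).len a ^ 2 * Real.exp (-(p.δG₀ * (geo9K i).dist a a')) else 0)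
  /-- overlap count of the cube supports. -/
  hcntG : ∀ a : (geo9K i).Site, (∑ k, if a ∈ SG k then (1 : ℝ) else 0) ≤ p.NG
  /-- the left entries of the cube terms, every direction. -/
  hTE : ∀ (μ : Fin (d + 1)) k, HasMajorant (g := toB6 (geo9K i) Rr Hp) (fun q : SiteY i × ι => ιB (blkOf i.D.toDomains q.1))
    (conj b (diffLetter (shiftY i) (UboxY i U) ((((etaS i : ℝ) : ℂ))⁻¹) (Sum.inl μ)) * conj b ((etaS i ^ 2) • T k)) (KE μ k)
  /-- their sum is a (3.42)₂-shape majorant. -/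
  hKE : ∀ (μ : Fin (d + 1)) a a', (∑ k, KE μ k a a') ≤ p.AE * (geo9K i).len a * Real.exp (-(p.δG₀ * (geo9K i).dist a a'))
  /-- (3.89) majorants of the remainders. -/
  h389 : ∀ k, HasMajorant (g := toB6 (geo9K i) Rr Hp) (fun q : SiteY i × ι => ιB (blkOf i.D.toDomains q.1)) (conj b (R k))
    (fun a a' => if a ∈ SG' k then p.θG * Real.exp (-(p.δG₀ * (geo9K i).dist a a')) else 0)
  /-- overlap count of the remainder supports. -/
  hcntG' : ∀ a : (geo9K i).Site, (∑ k, if a ∈ SG' k then (1 : ℝ) else 0) ≤ p.NG'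
  /-- (3.88): `Δ′_a(U; parSymY)·ΣT_□ = 1 − ΣR_□`. -/
  h388 : (deltaPrimeAY i (parSymY i) U).restrictScalars ℝ * (∑ k, T k) = 1 - ∑ k, R k
  /-- the index type of M5.6's cubes. -/
  κι : Type
  /-- it is finite. -/
  [instκι : Fintype κι]
  /-- the cube letters `G′_□(·)`. -/
  Oc : κι → SiteOpY (Matrix (Fin N) (Fin N) ℂ) i
  /-- the `χ_□ = 1` cores. -/
  Sχ : κι → Finset (geo9K i).Site
  /-- the supports of `h_□`. -/
  Sk : κι → Finset (geo9K i).Site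
  /-- the cut-offs `χ_□`. -/
  χ : κι → BlkY i → ℝ
  /-- the partition of unity `h_□`. -/
  h : κι → BlkY i → ℝ
  /-- the local inverses `C_□`. -/
  Cl : κι → Module.End ℝ (BlkY i → Matrix (Fin N) (Fin N) ℂ)
  /-- (3.42)₁-shape site majorants of the cube letters at the common amplitude∕rate. -/
  hGc : ∀ k, HasMajorant (g := toB6 (geo9K i) Rr Hp) (fun q : SiteY i × ι => ιB (blkOf i.D.toDomains q.1))
    (conj b ((etaS i ^ 2) • (Oc k U).restrictScalars ℝ)) (fun a a' => p.A * (geo9K i).len a ^ 2 * Real.exp (-(p.δG * (geo9K i).dist a a')))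
  /-- `Σ_□ h_□² = 1`. -/
  hsq : ∀ t, ∑ k, h k t ^ 2 = 1
  /-- `|h_□| ≤ 1`. -/
  hh : ∀ k t, |h k t| ≤ 1
  /-- `supp h_□ ⊂ S_□`. -/
  hS : ∀ k t, h k t ≠ 0 → ιB t ∈ Sk k
  /-- overlap count of M5.6's cover. -/
  hcnt : ∀ a : (geo9K i).Site, (∑ k, if a ∈ Sk k then (1 : ℝ) else 0) ≤ p.Nn
  /-- `0 ≤ χ_□ ≤ 1`. -/
  hχ01 : ∀ k t, 0 ≤ χ k t ∧ χ k t ≤ 1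
  /-- `χ_□ = 1` on the core. -/
  hχS : ∀ k t, ιB t ∈ Sχ k → χ k t = 1
  /-- separation of the core's complement from `supp h_□`. -/
  hsep : ∀ k a, a ∉ Sχ k → ∀ a'' ∈ Sk k, p.Dsep ≤ (geo9K i).dist a a''
  /-- slow variation of `h_□`. -/
  hLip : ∀ k (t t' : BlkY i), |h k t' - h k t| ≤ p.ℓ₀ + p.ℓ₁ * (geo9K i).dist (ιB t) (ιB t')
  /-- the local inverse property (M5.2-E). -/
  hloc : ∀ k, (cutMulY (𝔸 := Matrix (Fin N) (Fin N) ℂ) (h k)).restrictScalars ℝ *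
    ((cutMulY (𝔸 := Matrix (Fin N) (Fin N) ℂ) (χ k)).restrictScalars ℝ * (XY i (parKnitY i) (Oc k) U).restrictScalars ℝ) * Cl k *
      (cutMulY (𝔸 := Matrix (Fin N) (Fin N) ℂ) (h k)).restrictScalars ℝ =
    (cutMulY (𝔸 := Matrix (Fin N) (Fin N) ℂ) (h k)).restrictScalars ℝ * (cutMulY (𝔸 := Matrix (Fin N) (Fin N) ℂ) (h k)).restrictScalars ℝ
  /-- the per-cube (3.48) blocks of `C_□`. -/
  hC : ∀ k, HasMajorant (g := toB6 (geo9K i) Rr Hp) (fun q : BlkY i × ι => ιB q.1) (conj b (s • Cl k))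
    (fun a a' => if a ∈ Sk k then p.B₀ * ((geo9K i).len a ^ 4)⁻¹ * Real.exp (-(p.bb * p.δ₀ * (geo9K i).dist a a')) else 0)
  /-- the [2]-difference majorants (GAP G-B9-05). -/
  hD : ∀ k, HasMajorant (g := toB6 (geo9K i) Rr Hp) (fun q : BlkY i × ι => ιB q.1)
    (conj b ((etaS i ^ 2 * etaS i ^ 2) • ((XY i (parKnitY i) (GpY i (parKnitY i)) U).restrictScalars ℝ - (XY i (parKnitY i) (Oc k) U).restrictScalars ℝ)))
    (fun a a'' => p.κD * Real.exp (-(2 * p.δ₀ * p.Dsep)) * (geo9K i).len a ^ 4 * Real.exp (-(p.aD * p.δ₀ * (geo9K i).dist a a'')))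

variable {i U b ιB Rr Hp p s}

/-- **FILE A8's RECORD FROM ITS TWO HALVES**: geometry + analytic data ⟹ `KnitCubeInputs i U b ιB Rr Hp p c s`.
[cite: Balaban1985BackgroundPropagators, Thm 3.7 pp.409–410, Thm 3.9 p.413; Balaban1984PropagatorsII, Lemma 2.1 p.234, bookkeeping] -/
def KnitCubeInputs.ofGeometry {c : ℝ} (geo : KnitCubeGeometry i Rr Hp p c) (an : KnitCubeAnalytic i U b ιB Rr Hp p s) :
    KnitCubeInputs i U b ιB Rr Hp p c s :=
  letI : Fintype an.κ := an.instκ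
  letI : Fintype an.κι := an.instκι
  { hι := an.hι
    hcf := an.hcf
    hs := an.hs
    htri := geo.htri
    hrefl := geo.hrefl
    hsymm := geo.hsymm
    hdnn := geo.hdnn
    hrow := geo.hrow
    h261f := geo.h261f
    κ := an.κ
    SG := an.SG
    SG' := an.SG'
    T := an.T
    R := an.R
    KE := an.KE
    h261G₁ := geo.h261G₁
    h263G₁ := geo.h263G₁
    hT := an.hT
    hcntG := an.hcntG
    hTE := an.hTE
    hKE := an.hKE
    h389 := an.h389
    hcntG' := an.hcntG'
    h388 := an.h388
    h261G₂ := geo.h261G₂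
    h263G₂ := geo.h263G₂
    κι := an.κι
    Oc := an.Oc
    Sχ := an.Sχ
    Sk := an.Sk
    χ := an.χ
    h := an.h
    Cl := an.Cl
    hSTG := geo.hSTG
    h261Gw := geo.h261Gw
    hGc := an.hGc
    hST := geo.hST
    h261b := geo.h261b
    h261 := geo.h261
    h263 := geo.h263
    hsq := an.hsq
    hh := an.hh
    hS := an.hS
    hcnt := an.hcnt
    hχ01 := an.hχ01
    hχS := an.hχS
    hsep := an.hsep
    hLip := an.hLip
    hloc := an.hloc
    hC := an.hC
    hD := an.hD }

end Analytic

/-! ## §4 ★★★★★★★ The endpoint with the geometry discharged: catalogue above `M_L`, analytic cube data, (B)-lines -/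

section Endpoint

variable {N : ℕ} [NeZero N]
variable [instF : ∀ i : KIdx d ℓ hd hL b₀ b₁, Fintype (geo9K i).Site] [∀ i : KIdx d ℓ hd hL b₀ b₁, DecidableEq (geo9K i).Site]

/-- ★★★★★★★ **[B8] THM 2 AT THE `SU(N)`-VALUED SETUP-TORUS OBJECTS OF EVERY `PV d ℓ m K` FROM THE ANALYTIC CUBE DATA, THE (B)-LINES AND A CATALOGUE OF MEMBERS
ABOVE THE GEOMETRY THRESHOLD** (`1 ≤ N ≤ 25`, `d + 1 ≥ 2`, `L = ℓ + 1`): for the (B)-line constants `B₀ ≥ 2∕(5(d+1)L)`, `c_B9 > 0`, a threshold `c_L > 0`, cube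
scalars `p` with `p.Valid d ℓ b M₂`, `KnitCubeGeoValid … p dρ` and the slack coupling `c_L·L^{2e_s} < α₀′`, a catalogue `memF` (sections `ιBF`, units `sF`) — THERE EXIST
`M_L` and `B₁, B₂, c₁ > 0` such that for EVERY `m K k η` (`1 ≤ k ≤ m + K`, `η > 0`), with `P₀ = sitesPerDir 0`: catalogue props (period `P₀`, constant level `n`,
nominal index `≤ n + e_s`, `M_L ≤ M` at every member) → analytic cube data `KnitCubeAnalytic` at every member and every `SU(N)`-valued `P₀`-periodic
`U₀ ∈ 𝔄_n(T_η, α₀)`, `α₀ ≤ c_L` → (B)-lines `B9P3PerAt` → `Thm2SetupSUAt (PV d ℓ m K hd hL) N k η 0 B₁ B₂ c₁ len (fun _ => True)` (file A9's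
`thm2SetupSUAt_ofCubes_exists` ∘ `exists_threshold_knitCubeGeometry` ∘ `KnitCubeInputs.ofGeometry`, `c := c₁(dρ, ρ_f, 1)`).  HONEST SCOPE: the three arrows'
antecedents are displayed, inhabited by nothing here; no estimate of [B8]∕[B9] is proved in files A1–A10; `stub_PV3A` NOT discharged; the Yang–Mills mass gap
is NOT proved. [cite: Balaban1985RegularSpaces, Thm 2 p.83 («there exists B₁»), (1.33)–(1.39) pp.82–83, p.77 («Ω_j = T_η»), p.76 («G = SU(N)»); Balaban1985BackgroundPropagators, Thm 3.1 p.397 («for M ≥ M₁»), Thm 3.7 pp.409–410, Thm 3.9 p.413 («For M sufficiently large»), Thm 3.2 (3.48) p.398; Balaban1984PropagatorsII, Lemma 2.1 p.234; Balaban1985Averaging, (4) p.18, Prop. 2 p.26] -/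
theorem thm2SetupSUAt_ofCubeAnalytic_exists (hN : N ≤ 25) (hd2 : 2 ≤ d + 1)
    {B₀ B₀β cB9 β cL : ℝ} {len : LSite (d + 1) → ℝ}
    (hB₀ : 0 < B₀) (hB : 2 ≤ 5 * ((d + 1 : ℕ) : ℝ) * ((ℓ + 1 : ℕ) : ℝ) * B₀) (hcB9 : 0 < cB9) (hcL : 0 < cL)
    {ι : Type} [Fintype ι] [DecidableEq ι] {b : Module.Basis ι ℝ (Matrix (Fin N) (Fin N) ℂ)} {M₂ : ℝ}
    (p : KnitCubeParams) (hp : p.Valid d ℓ b M₂) {dρ : ℕ} (hg : KnitCubeGeoValid d ℓ hd hL b₀ b₁ p dρ) (es : ℕ)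
    (hαe : cL * (((ℓ + 1 : ℕ) : ℝ)) ^ (2 * es) < p.α₀')
    (memF : ℕ → ℤ → ℕ → KIdx d ℓ hd hL b₀ b₁) (ιBF : ∀ k P n, BlkY (memF k P n) → IBondY (memF k P n)) (Rr : ℝ) (Hp : Prop) (sF : ℕ → ℤ → ℕ → ℝ) :
    letI : CStarAlgebra (Matrix (Fin N) (Fin N) ℂ) := {}
    ∃ ML B₁ B₂ c₁ : ℝ, 0 < B₁ ∧ 0 < B₂ ∧ 0 < c₁ ∧ ∀ (m K k : ℕ) (η : ℝ), 1 ≤ k → k ≤ m + K → 0 < η →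
      (∀ n, 1 ≤ n → n ≤ k → (((PV d ℓ (memF k (((PV d ℓ m K hd hL).sitesPerDir 0 : ℕ) : ℤ) n).m
          (memF k (((PV d ℓ m K hd hL).sitesPerDir 0 : ℕ) : ℤ) n).K hd hL).sitesPerDir 0 : ℕ) : ℤ) = (((PV d ℓ m K hd hL).sitesPerDir 0 : ℕ) : ℤ)) →
      (∀ n, 1 ≤ n → n ≤ k → ∀ z : SiteY (memF k (((PV d ℓ m K hd hL).sitesPerDir 0 : ℕ) : ℤ) n),
          levY (memF k (((PV d ℓ m K hd hL).sitesPerDir 0 : ℕ) : ℤ) n) z = n) →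
      (∀ n, 1 ≤ n → n ≤ k → (memF k (((PV d ℓ m K hd hL).sitesPerDir 0 : ℕ) : ℤ) n).k ≤ n + es) →
      (∀ n, 1 ≤ n → n ≤ k → ML ≤ (geo9K (memF k (((PV d ℓ m K hd hL).sitesPerDir 0 : ℕ) : ℤ) n)).M) →
      (∀ n, 1 ≤ n → n ≤ k → ∀ ⦃α₀ : ℝ⦄, 0 < α₀ → α₀ ≤ cL → ∀ U₀ : LSite (d + 1) → Fin (d + 1) → (Matrix (Fin N) (Fin N) ℂ)ˣ,
          (∀ x κ, U₀ x κ ∈ specialUnitaryUnits (Fin N)) →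
          (∀ (x : LSite (d + 1)) (μ : Fin (d + 1)), U₀ (x + (((PV d ℓ m K hd hL).sitesPerDir 0 : ℕ) : ℤ) • e μ) = U₀ x) →
          InAk (ℓ + 1) n η α₀ (fun _ => (Set.univ : Set (LSite (d + 1)))) U₀ →
          Nonempty (KnitCubeAnalytic (memF k (((PV d ℓ m K hd hL).sitesPerDir 0 : ℕ) : ℤ) n)
            (bgY (memF k (((PV d ℓ m K hd hL).sitesPerDir 0 : ℕ) : ℤ) n) U₀) b (ιBF k (((PV d ℓ m K hd hL).sitesPerDir 0 : ℕ) : ℤ) n) Rr Hp p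
            (sF k (((PV d ℓ m K hd hL).sitesPerDir 0 : ℕ) : ℤ) n))) →
      (∀ m', m' ≤ k → ∀ ⦃α₀ : ℝ⦄, 0 < α₀ → α₀ ≤ cL → ∀ U₀ : LSite (d + 1) → Fin (d + 1) → (Matrix (Fin N) (Fin N) ℂ)ˣ,
          (∀ x κ, U₀ x κ ∈ specialUnitaryUnits (Fin N)) →
          (∀ (x : LSite (d + 1)) (μ : Fin (d + 1)), U₀ (x + (((PV d ℓ m K hd hL).sitesPerDir 0 : ℕ) : ℤ) • e μ) = U₀ x) →
          InAk (ℓ + 1) m' η α₀ (fun _ => (Set.univ : Set (LSite (d + 1)))) U₀ →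
          B9P3PerAt (𝔸 := Matrix (Fin N) (Fin N) ℂ) (ℓ + 1) B₀ B₀β cB9 β len η m' α₀ (((PV d ℓ m K hd hL).sitesPerDir 0 : ℕ) : ℤ) U₀) →
      Thm2SetupSUAt (PV d ℓ m K hd hL) N k η 0 B₁ B₂ c₁ len (fun _ => True) := by
  letI : CStarAlgebra (Matrix (Fin N) (Fin N) ℂ) := {}
  obtain ⟨ML, hgeo⟩ := exists_threshold_knitCubeGeometry (d := d) (ℓ := ℓ) (hd := hd) (hL := hL) (b₀ := b₀) (b₁ := b₁) Rr Hp hg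
  obtain ⟨B₁, B₂, c₁, hB₁, hB₂, hc₁, H⟩ :=
    thm2SetupSUAt_ofCubes_exists (len := len) (B₀β := B₀β) (β := β) (c := B6.c1 dρ p.ρf 1) hN hd2 hB₀ hB hcB9 hcL p hp es hαe memF ιBF Rr Hp sF
  refine ⟨ML, B₁, B₂, c₁, hB₁, hB₂, hc₁, fun m K k η hk hkK hη hP hlev hke hM han hb9 => H m K k η hk hkK hη hP hlev hke ?_ hb9⟩
  intro n hn hnk α₀ hα hαc U₀ hU₀G hU₀per hA
  obtain ⟨an⟩ := han n hn hnk hα hαc U₀ hU₀G hU₀per hA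
  exact ⟨KnitCubeInputs.ofGeometry (hgeo _ (hM n hn hnk)) an⟩

end Endpoint

end Literature.MathematicalPhysics.QuantumFieldTheory.Balaban1983to89.B8Thm2TorusKnitCubeGeometry

end
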